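import Summits.AtomisticToContinuum.Crystallization.Theorems.OverbindingBudgetAffineFarFieldCellTaylor

/-!
# OverbindingBudget (2c) — part 27Vb-S(A): symmetry ⇒ moment data (lens-4 g93/g94 ed.2; r1659 S3 groundwork)

Support file, pure analysis on `ℝ³ = EuclideanSpace ℝ (Fin 3)`, no atlas (file 1 of 2 of part 27Vb-S; file 2 is
`…FarFieldCellMove`, the transport under affine isometries).  How the per-letter Voronoi cells of 27Vb FEED
the typed interface `IsMomentCell` of part 27Va-B without computing nine moments:

* `IsInvariantUnder K p T` — `K` is mapped into itself by `x ↦ p + T(x − p)` (`T` a linear isometry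
  equivalence); `setIntegral_comp_inv` — then `∫_K g(p + T(x − p)) = ∫_K g` (measure-preserving change
  of variables, as in `integral_cubic_eq_zero`);
* `flipIso k` (coordinate sign flip), `cycIso` (coordinate 3-cycle) — the generators used;
  `centrallySymmetric_of_flips`, `integral_sub_eq_zero` (centroid), `moment_offdiag_eq_zero`,
  `moment_diag_cyc` — flips kill the off-diagonal second moments, the 3-cycle equalises the diagonal;
* `isMomentCell_of_symmetry` — a compact star-shaped cell invariant about `p` under the three flips and
  the 3-cycle, with `|∫_K ‖x−p‖² − 3σ|K|| ≤ 3δ₀|K|`, `∫‖x−p‖³ ≤ μ₃|K|`, `∫‖x−p‖⁴ ≤ μ₄|K|`, satisfies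
  `IsMomentCell K p σ (9δ₀) μ₃ μ₄` (via `secondMoment_form_of_coords`): ONE scalar second moment per
  letter instead of nine.
-/

namespace Summit.AtomisticToContinuum.Crystallization.Theorems.OverbindingBudgetAffineFarFieldCellSymm

noncomputable section

open MeasureTheory
open Summit.AtomisticToContinuum.Crystallization.Theorems.OverbindingBudgetAffineFarFieldCellTaylor

local notation "E3" => EuclideanSpace ℝ (Fin 3)

/-- support: `K` is mapped into itself by the affine isometry `x ↦ p + T (x - p)`. -/
def IsInvariantUnder (K : Set E3) (p : E3) (T : E3 ≃ₗᵢ[ℝ] E3) : Prop :=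
  ∀ x ∈ K, p + T (x - p) ∈ K

/-- Change of variables under a symmetry of the cell: `∫_K g(p + T(x - p)) = ∫_K g`. -/
theorem setIntegral_comp_inv {K : Set E3} {p : E3} {T : E3 ≃ₗᵢ[ℝ] E3}
    (hT : IsInvariantUnder K p T) (hT' : IsInvariantUnder K p T.symm)
    {F : Type*} [NormedAddCommGroup F] [NormedSpace ℝ F] (g : E3 → F) :
    ∫ x in K, g (p + T (x - p)) = ∫ x in K, g x := by
  set Φ : E3 → E3 := fun x => p + T (x - p) with hΦ
  have hmp : MeasurePreserving Φ volume volume :=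
    (measurePreserving_add_left volume p).comp
      (T.measurePreserving.comp (measurePreserving_sub_right volume p))
  have hme : MeasurableEmbedding Φ :=
    (measurableEmbedding_addLeft p).comp
      (T.toMeasurableEquiv.measurableEmbedding.comp (measurableEmbedding_subRight p))
  have hpre : Φ ⁻¹' K = K := by
    ext x
    constructor
    · intro hx
      have h := hT' _ hx
      have e : p + T.symm (Φ x - p) = x := by simp [hΦ]
      rwa [e] at h
    · intro hx
      exact hT x hx
  have h := hmp.setIntegral_preimage_emb hme g K
  rwa [hpre] at h

/-- support: the coordinate sign flip `v ↦ v - 2 v_k e_k` as a linear map. -/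
def flipLin (k : Fin 3) : E3 →ₗ[ℝ] E3 where
  toFun v := v - (2 * v k) • e3 k
  map_add' u v := by
    simp only [PiLp.add_apply]
    rw [mul_add, add_smul]
    abel
  map_smul' c v := by
    simp only [PiLp.smul_apply, smul_eq_mul, RingHom.id_apply, smul_sub, smul_smul]
    ring_nf

/-- Coordinates of the frame vectors: `(e3 k)_i = δ_ik`. -/
theorem e3_apply (k i : Fin 3) : e3 k i = if i = k then 1 else 0 := by
  fin_cases k <;> fin_cases i <;> simp [e3]

/-- `flipLin k` negates the `k`-th coordinate and fixes the others. -/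
theorem flipLin_apply (k : Fin 3) (v : E3) (i : Fin 3) :
    flipLin k v i = if i = k then -v i else v i := by
  simp only [flipLin, LinearMap.coe_mk, AddHom.coe_mk, PiLp.sub_apply, PiLp.smul_apply, e3_apply,
    smul_eq_mul]
  split_ifs with h
  · subst h; ring
  · ring

/-- `flipLin k` is an involution. -/
theorem flipLin_involutive (k : Fin 3) : Function.Involutive (flipLin k) := by
  intro v
  ext i
  rw [flipLin_apply, flipLin_apply]
  split_ifs <;> ring

/-- `flipLin k` preserves the Euclidean norm. -/
theorem norm_flipLin (k : Fin 3) (v : E3) : ‖flipLin k v‖ = ‖v‖ := by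
  rw [EuclideanSpace.norm_eq, EuclideanSpace.norm_eq]
  congr 1
  refine Finset.sum_congr rfl (fun i _ => ?_)
  rw [flipLin_apply]
  split_ifs <;> simp

/-- support: the coordinate sign flip as a linear isometry equivalence. -/
def flipIso (k : Fin 3) : E3 ≃ₗᵢ[ℝ] E3 :=
  { LinearEquiv.ofInvolutive (flipLin k) (flipLin_involutive k) with
    norm_map' := norm_flipLin k }

/-- `flipIso k` negates the `k`-th coordinate and fixes the others. -/
@[simp] theorem flipIso_apply (k : Fin 3) (v : E3) (i : Fin 3) :
    flipIso k v i = if i = k then -v i else v i := flipLin_apply k v i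

/-- `flipIso k` is its own inverse. -/
theorem flipIso_symm (k : Fin 3) : (flipIso k).symm = flipIso k := by
  ext v i
  have h : flipIso k ((flipIso k).symm v) = v := (flipIso k).apply_symm_apply v
  have h' : flipIso k (flipIso k v) = v := flipLin_involutive k v
  have hinj : Function.Injective (flipIso k) := (flipIso k).injective
  have : (flipIso k).symm v = flipIso k v := hinj (h.trans h'.symm)
  rw [this]

/-- support: the cyclic coordinate permutation `(v₀, v₁, v₂) ↦ (v₂, v₀, v₁)`. -/
def cycIso : E3 ≃ₗᵢ[ℝ] E3 := LinearIsometryEquiv.piLpCongrLeft 2 ℝ ℝ (finRotate 3)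

/-- Coordinates of `cycIso v`. -/
theorem cycIso_apply (v : E3) (i : Fin 3) : cycIso v i = v ((finRotate 3).symm i) := by
  simp [cycIso, LinearIsometryEquiv.piLpCongrLeft_apply, Equiv.piCongrLeft'_apply]

/-- `(cycIso v)_0 = v_2`. -/
theorem cycIso_apply_zero (v : E3) : cycIso v 0 = v 2 := by
  rw [cycIso_apply]; rfl
/-- `(cycIso v)_1 = v_0`. -/
theorem cycIso_apply_one (v : E3) : cycIso v 1 = v 0 := by
  rw [cycIso_apply]; rfl
/-- `(cycIso v)_2 = v_1`. -/
theorem cycIso_apply_two (v : E3) : cycIso v 2 = v 1 := by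
  rw [cycIso_apply]; rfl
/-- `(cycIso⁻¹ v)_0 = v_1`. -/
theorem cycIso_symm_apply_zero (v : E3) : cycIso.symm v 0 = v 1 := by
  simp [cycIso, LinearIsometryEquiv.piLpCongrLeft_apply, Equiv.piCongrLeft'_apply]
/-- `(cycIso⁻¹ v)_1 = v_2`. -/
theorem cycIso_symm_apply_one (v : E3) : cycIso.symm v 1 = v 2 := by
  simp [cycIso, LinearIsometryEquiv.piLpCongrLeft_apply, Equiv.piCongrLeft'_apply]
/-- `(cycIso⁻¹ v)_2 = v_0`. -/
theorem cycIso_symm_apply_two (v : E3) : cycIso.symm v 2 = v 0 := by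
  simp [cycIso, LinearIsometryEquiv.piLpCongrLeft_apply, Equiv.piCongrLeft'_apply]

/-! ### Symmetry ⇒ the moment clauses -/

/-- Invariance under the three coordinate flips gives central symmetry about `p`. -/
theorem centrallySymmetric_of_flips {K : Set E3} {p : E3}
    (h : ∀ k, IsInvariantUnder K p (flipIso k)) : IsCentrallySymmetric K p := by
  intro x hx
  have h0 := h 0 x hx
  have h1 := h 1 _ h0
  have h2 := h 2 _ h1
  simp only [add_sub_cancel_left] at h2
  convert h2 using 1
  ext i
  simp only [PiLp.sub_apply, PiLp.smul_apply, PiLp.add_apply, flipIso_apply, smul_eq_mul]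
  fin_cases i <;> simp <;> ring

/-- Central symmetry ⇒ the centroid is `p` (vector form). -/
theorem integral_sub_eq_zero {K : Set E3} {p : E3} (hS : IsCentrallySymmetric K p) :
    ∫ x in K, (x - p) = 0 := by
  set r : E3 → E3 := fun x => (2 : ℝ) • p - x with hr
  have hmp : MeasurePreserving r volume volume :=
    Measure.measurePreserving_sub_left volume ((2 : ℝ) • p)
  have hme : MeasurableEmbedding r := measurableEmbedding_subLeft ((2 : ℝ) • p)
  have hrr : ∀ x, r (r x) = x := by intro x; simp [hr]
  have hrK : r ⁻¹' K = K := by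
    ext x
    constructor
    · intro hx
      have h := hS _ hx
      rwa [show (2 : ℝ) • p - r x = x from hrr x] at h
    · intro hx
      exact hS x hx
  have h := hmp.setIntegral_preimage_emb hme (fun y => y - p) K
  rw [hrK] at h
  have hodd : ∀ x, r x - p = -(x - p) := by
    intro x; simp only [hr, two_smul]; abel
  simp_rw [hodd, integral_neg] at h
  have h2 : (2 : ℝ) • (∫ x in K, (x - p)) = 0 := by
    rw [two_smul]
    nth_rw 1 [← h]
    exact neg_add_cancel _
  exact (smul_eq_zero.mp h2).resolve_left two_ne_zero

/-- A flip symmetry kills the off-diagonal second moments. -/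
theorem moment_offdiag_eq_zero {K : Set E3} {p : E3} {i j : Fin 3} (hij : i ≠ j)
    (h : IsInvariantUnder K p (flipIso i)) : ∫ x in K, (x - p) i * (x - p) j = 0 := by
  have h' : IsInvariantUnder K p (flipIso i).symm := by rw [flipIso_symm]; exact h
  have e := setIntegral_comp_inv h h' (fun y : E3 => (y - p) i * (y - p) j)
  simp only [add_sub_cancel_left, flipIso_apply, reduceIte, if_neg (Ne.symm hij), neg_mul,
    integral_neg] at e
  linarith

/-- The cyclic symmetry makes the diagonal second moments equal. -/
theorem moment_diag_cyc {K : Set E3} {p : E3}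
    (h : IsInvariantUnder K p cycIso) (h' : IsInvariantUnder K p cycIso.symm) :
    (∫ x in K, (x - p) 0 * (x - p) 0) = (∫ x in K, (x - p) 2 * (x - p) 2) ∧
    (∫ x in K, (x - p) 1 * (x - p) 1) = (∫ x in K, (x - p) 0 * (x - p) 0) := by
  constructor
  · have e := setIntegral_comp_inv h h' (fun y : E3 => (y - p) 0 * (y - p) 0)
    simp only [add_sub_cancel_left, cycIso_apply_zero] at e
    exact e.symm
  · have e := setIntegral_comp_inv h h' (fun y : E3 => (y - p) 1 * (y - p) 1)
    simp only [add_sub_cancel_left, cycIso_apply_one] at e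
    exact e.symm

/-- **Symmetric cell ⇒ moment data.**  A compact star-shaped cell invariant (about `p`) under the three
coordinate flips and the coordinate 3-cycle has centroid `p` and EXACTLY isotropic second moments;
with `|∫‖x-p‖² - 3σ|K|| ≤ 3δ₀|K|` it satisfies `IsMomentCell K p σ (9δ₀) μ₃ μ₄`. -/
theorem isMomentCell_of_symmetry {K : Set E3} {p : E3} (hKc : IsCompact K)
    (hKs : StarConvex ℝ p K) (hpK : p ∈ K) (hflip : ∀ k, IsInvariantUnder K p (flipIso k))
    (hcyc : IsInvariantUnder K p cycIso) (hcyc' : IsInvariantUnder K p cycIso.symm)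
    {σ δ₀ μ₃ μ₄ : ℝ} (hδ₀ : 0 ≤ δ₀)
    (hσ : |(∫ x in K, ‖x - p‖ ^ 2) - 3 * σ * (volume K).toReal| ≤ 3 * δ₀ * (volume K).toReal)
    (h3 : (∫ x in K, ‖x - p‖ ^ 3) ≤ μ₃ * (volume K).toReal)
    (h4 : (∫ x in K, ‖x - p‖ ^ 4) ≤ μ₄ * (volume K).toReal) :
    IsMomentCell K p σ (9 * δ₀) μ₃ μ₄ := by
  set vol := (volume K).toReal with hvol
  have hvol0 : 0 ≤ vol := ENNReal.toReal_nonneg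
  have hsubc : Continuous fun x : E3 => x - p := continuous_id.sub continuous_const
  have hci : ∀ i : Fin 3, Continuous fun x : E3 => (x - p) i :=
    fun i => (EuclideanSpace.proj i).continuous.comp hsubc
  have hint : ∀ i j : Fin 3, IntegrableOn (fun x : E3 => (x - p) i * (x - p) j) K :=
    fun i j => ((hci i).mul (hci j)).continuousOn.integrableOn_compact hKc
  have hsum : (∫ x in K, ‖x - p‖ ^ 2) = (∫ x in K, (x - p) 0 * (x - p) 0)
      + (∫ x in K, (x - p) 1 * (x - p) 1) + (∫ x in K, (x - p) 2 * (x - p) 2) := by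
    have e : (fun x : E3 => ‖x - p‖ ^ 2)
        = fun x => (x - p) 0 * (x - p) 0 + (x - p) 1 * (x - p) 1 + (x - p) 2 * (x - p) 2 := by
      funext x
      rw [EuclideanSpace.real_norm_sq_eq, Fin.sum_univ_three]
      ring
    have i1 := integral_add (hint 0 0) (hint 1 1)
    have i2 := integral_add ((hint 0 0).add (hint 1 1)) (hint 2 2)
    simp only [Pi.add_apply] at i2
    rw [e, i2, i1]
  obtain ⟨d02, d10⟩ := moment_diag_cyc hcyc hcyc'
  have key : |(∫ x in K, (x - p) 0 * (x - p) 0) - σ * vol| ≤ δ₀ * vol := by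
    have h' := hσ
    rw [hsum, d10, ← d02] at h'
    rw [abs_le] at h' ⊢
    constructor <;> linarith [h'.1, h'.2]
  have hdiag : ∀ i : Fin 3, |(∫ x in K, (x - p) i * (x - p) i) - σ * vol| ≤ δ₀ * vol := by
    intro i
    fin_cases i
    · exact key
    · show |(∫ x in K, (x - p) 1 * (x - p) 1) - σ * vol| ≤ δ₀ * vol
      rw [d10]; exact key
    · show |(∫ x in K, (x - p) 2 * (x - p) 2) - σ * vol| ≤ δ₀ * vol
      rw [← d02]; exact key
  have hm : ∀ i j : Fin 3, |(∫ x in K, (x - p) i * (x - p) j)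
      - σ * vol * (if i = j then 1 else 0)| ≤ δ₀ * vol := by
    intro i j
    by_cases hij : i = j
    · subst hij
      simpa using hdiag i
    · rw [moment_offdiag_eq_zero hij (hflip i), if_neg hij]
      simp only [mul_zero, sub_zero, abs_zero]
      positivity
  refine ⟨hKc, hKs, hpK, by positivity, ?_, ?_, h3, h4⟩
  · exact integral_sub_eq_zero (centrallySymmetric_of_flips hflip)
  · intro B
    exact secondMoment_form_of_coords hKc hm B

end

end Summit.AtomisticToContinuum.Crystallization.Theorems.OverbindingBudgetAffineFarFieldCellSymm
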